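import Summits.MatrixMultiplication.MatrixMultiplication.Theorems.FarEdgeDescentTowerRatio
import HarnessLib

/-!
# Far-edge descent, kernel XXX-B2: the virtual deviation step of the full-class crude tower

Route `FarEdgeDescent`, special leaf `FiniteSaturation` (stmt-MatrixMultiplication-23739): helper
kernel, THESES-FREE and def-free; second of the three XXX-B files (see XXX-B1
`FarEdgeDescentTowerRatio` for the setting).  On a sub-tangent `(s,t) = (1+v, 1−u)` of
`y ↦ ω(1,y,1)` the normalised virtual value `γ_j = G_j/r_j` of the XXX-A chain obeys
`γ_{j+1}(1+φ(m_j)) = (θ_j+γ_j)⁷ − θ_j⁷` with anchor weight `θ_j = Q_j^t/r_j ∈ [1−2m_j − 3u·7ʲ, 1−2m_j]`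
and the cap `(θ_j+γ_j)⁷ − θ_j⁷ ≤ 1` (§3, `virtual_normalForm`, from the readout and
`log r_j ≤ 3·7ʲ`); convexity of `x⁷` gives the deviation step
`γ_{j+1} − m_{j+1} ≥ λ(m_j)(γ_j − m_j) − 14·((1−2m_j) − θ_j)` (`virtual_deviation_step`), the cap
forces `γ_j − m_j ≤ 7/10` once the anchor deficit is `≤ 7/100` (`deviation_le_of_cap`), a certified
lower bound `a − b ≤ γ_j − m_j` is transported one stage with any multiplier lower bound
(`deviation_transport`) at a loss budget `lo·(0.19/7^(n+1−j)) + 14·(3u·7ʲ) ≤ 0.19/7^(n−j)` when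
`3u·7ⁿ ≤ 1/100` (`loss_budget`), and the initial deviation is `γ₀ − m₀ = (2^s−2)/6 ≥ v/5`
(`initial_deviation`).  Also the constants of XXX-B3: `0 < κ = log₇(179/100) < 1`, the tower order
`κ/(1−κ) > 21/50 > log 2/log(11/2)` (`towerOrder_gt`, `pairOrder_lt_towerOrder`: `1.79^71 > 7^21`,
`2^50 < (11/2)^21`).

References: Pan 1984 (LNCS 179) §17, Thm. 17.1; Lotti–Romani 1983, Thm. 3.1, Prop. 4.1.
-/

set_option linter.dupNamespace false

noncomputable section

open scoped BigOperators

namespace Summit.MatrixMultiplication.MatrixMultiplication.Theorems.FarEdgeDescentTowerDeviation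

open Literature.Computability.AlgebraicComplexity
open Summit.MatrixMultiplication.MatrixMultiplication.Theorems.FarEdgeDescentTowerRatio

variable (K : Type) [Field K]

/-! ## §3 The virtual side: cap, deviation step, violation -/

/-- From the normalised readout `(θ+γ)⁷ − θ⁷ ≤ 1` and `0 ≤ θ ≤ 1`: `θ + γ ≤ 1.105`. [folklore] -/
theorem sum_le_of_cap {θ γ : ℝ} (hθ0 : 0 ≤ θ) (hθ1 : θ ≤ 1)
    (hcap : (θ + γ) ^ 7 - θ ^ 7 ≤ 1) : θ + γ ≤ 1105 / 1000 := by
  by_contra h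
  push Not at h
  have h1 : ((1105 : ℝ) / 1000) ^ 7 < (θ + γ) ^ 7 := pow_lt_pow_left₀ h (by norm_num) (by norm_num)
  have h2 : θ ^ 7 ≤ 1 := pow_le_one₀ hθ0 hθ1
  have h3 : (2 : ℝ) ≤ ((1105 : ℝ) / 1000) ^ 7 := by norm_num
  linarith

/-- **Violation bound**: under the cap, `γ − m ≤ 7/10` as soon as the anchor deficit
`(1 − 2m) − θ` is at most `7/100`. [folklore] -/
theorem deviation_le_of_cap {m θ γ : ℝ} (hθ0 : 0 ≤ θ) (hθ1 : θ ≤ 1)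
    (hdef : (1 - 2 * m) - θ ≤ 7 / 100) (hcap : (θ + γ) ^ 7 - θ ^ 7 ≤ 1) :
    γ - m ≤ 7 / 10 := by
  have := sum_le_of_cap hθ0 hθ1 hcap
  linarith

/-- **Virtual deviation step.**  With `φ = (1−m)⁷ − (1−2m)⁷`, the next deviation `γ' − m'`
(`γ'(1+φ) = (θ+γ)⁷ − θ⁷`, `m'(1+φ) = φ`) is at least `λ(m)(γ − m) − 14((1−2m) − θ)`,
`λ(m) = 7(1−m)⁶/(1+φ)`, provided the anchor deficit is `≤ 1/100` and the cap holds. [folklore] -/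
theorem virtual_deviation_step {m θ γ γ' m' : ℝ} (hm0 : 0 ≤ m) (hm1 : m ≤ 1 / 2) (hγ : 0 ≤ γ)
    (hθ0 : 0 ≤ θ) (hθρ : θ ≤ 1 - 2 * m) (hdef : (1 - 2 * m) - θ ≤ 1 / 100)
    (hcap : (θ + γ) ^ 7 - θ ^ 7 ≤ 1)
    (hγ' : γ' * (1 + ((1 - m) ^ 7 - (1 - 2 * m) ^ 7)) = (θ + γ) ^ 7 - θ ^ 7)
    (hm' : m' * (1 + ((1 - m) ^ 7 - (1 - 2 * m) ^ 7)) = (1 - m) ^ 7 - (1 - 2 * m) ^ 7) :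
    7 * (1 - m) ^ 6 / (1 + ((1 - m) ^ 7 - (1 - 2 * m) ^ 7)) * (γ - m) - 14 * ((1 - 2 * m) - θ) ≤
      γ' - m' := by
  have hφ0 := phi_nonneg hm0 hm1
  have hPpos : 0 < 1 + ((1 - m) ^ 7 - (1 - 2 * m) ^ 7) := by linarith
  have hθ1 : θ ≤ 1 := by linarith
  have hsum := sum_le_of_cap hθ0 hθ1 hcap
  have hd0 : 0 ≤ (1 - 2 * m) - θ := by linarith
  have hρg0 : 0 ≤ 1 - 2 * m + γ := by linarith
  have hρg : 1 - 2 * m + γ ≤ 1115 / 1000 := by linarith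
  have h6 : (1 - 2 * m + γ) ^ 6 ≤ 2 := by
    have := pow_le_pow_left₀ hρg0 hρg 6
    have h' : ((1115 : ℝ) / 1000) ^ 6 ≤ 2 := by norm_num
    linarith
  have dev := deviation_step m θ γ hθ0 hθρ hγ
  have e1 : 7 * (1 - 2 * m + γ) ^ 6 * (1 - 2 * m - θ) ≤ 14 * ((1 - 2 * m) - θ) := by
    nlinarith [mul_nonneg (sub_nonneg.2 h6) hd0]
  have e2 : 14 * ((1 - 2 * m) - θ) ≤
      14 * (1 + ((1 - m) ^ 7 - (1 - 2 * m) ^ 7)) * ((1 - 2 * m) - θ) := by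
    nlinarith [mul_nonneg hφ0 hd0]
  have key : 7 * (1 - m) ^ 6 * (γ - m) -
      14 * (1 + ((1 - m) ^ 7 - (1 - 2 * m) ^ 7)) * ((1 - 2 * m) - θ) ≤
      (γ' - m') * (1 + ((1 - m) ^ 7 - (1 - 2 * m) ^ 7)) := by
    rw [sub_mul, hγ', hm']
    linarith [dev, e1, e2]
  have e3 : 7 * (1 - m) ^ 6 / (1 + ((1 - m) ^ 7 - (1 - 2 * m) ^ 7)) * (γ - m) =
      (7 * (1 - m) ^ 6 * (γ - m)) / (1 + ((1 - m) ^ 7 - (1 - 2 * m) ^ 7)) := by ring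
  rw [e3, sub_le_iff_le_add, div_le_iff₀ hPpos]
  have e4 : (γ' - m' + 14 * ((1 - 2 * m) - θ)) * (1 + ((1 - m) ^ 7 - (1 - 2 * m) ^ 7)) =
      (γ' - m') * (1 + ((1 - m) ^ 7 - (1 - 2 * m) ^ 7)) +
        14 * (1 + ((1 - m) ^ 7 - (1 - 2 * m) ^ 7)) * ((1 - 2 * m) - θ) := by ring
  rw [e4]
  linarith [key]

/-- `1 − Q^(t−1) ≤ (1 − t) log Q` for `Q ≥ 1`. [folklore] -/
theorem one_sub_rpow_le_mul_log {Q t : ℝ} (hQ : 1 ≤ Q) :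
    1 - Q ^ (t - 1) ≤ (1 - t) * Real.log Q := by
  have hQpos : 0 < Q := by linarith
  rw [Real.rpow_def_of_pos hQpos]
  have := Real.add_one_le_exp (Real.log Q * (t - 1))
  nlinarith

section Virtual

variable (r Q L : ℕ → ℕ) (G : ℕ → ℝ → ℝ → ℝ)

/-- The virtual values are nonnegative. [folklore] -/
theorem virtual_nonneg (hG0 : ∀ s t : ℝ, G 0 s t = (2 : ℝ) ^ s)
    (hG : ∀ j (s t : ℝ), G (j + 1) s t =
      (((Q j : ℕ) : ℝ) ^ t + G j s t) ^ 7 - (((Q j : ℕ) : ℝ) ^ t) ^ 7)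
    (s t : ℝ) : ∀ j, 0 ≤ G j s t := by
  intro j
  induction j with
  | zero => rw [hG0]; positivity
  | succ j ih =>
    rw [hG]
    have hq : 0 ≤ ((Q j : ℕ) : ℝ) ^ t := Real.rpow_nonneg (Nat.cast_nonneg _) t
    have := pow_le_pow_left₀ hq (by linarith : ((Q j : ℕ) : ℝ) ^ t ≤ ((Q j : ℕ) : ℝ) ^ t + G j s t) 7
    linarith

/-- **Virtual normal form of stage `j`** on a sub-tangent `(s,t)`, in the ratios
`m = L_j/r_j`, `θ = Q_j^t/r_j`, `γ = G_j/r_j`: `0 ≤ θ ≤ 1 − 2m`, anchor deficit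
`(1−2m) − θ ≤ (1−t)·3·7^j`, the cap `(θ+γ)⁷ − θ⁷ ≤ 1`, and the recursion
`γ'(1+φ(m)) = (θ+γ)⁷ − θ⁷`. [folklore] -/
theorem virtual_normalForm
    (hL : ∀ j, L (j + 1) = (Q j + L j) ^ 7 - Q j ^ 7) (hr : ∀ j, r (j + 1) = r j ^ 7 + L (j + 1))
    (hQ1 : ∀ j, 1 ≤ Q j) (hall : ∀ j, (Q j + L j) ^ 7 ≤ r j ^ 7) (h0 : r 0 = 6)
    (hsum : ∀ j, Q j + 2 * L j = r j)
    (hG0 : ∀ s t : ℝ, G 0 s t = (2 : ℝ) ^ s)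
    (hG : ∀ j (s t : ℝ), G (j + 1) s t =
      (((Q j : ℕ) : ℝ) ^ t + G j s t) ^ 7 - (((Q j : ℕ) : ℝ) ^ t) ^ 7)
    (hread : ∀ j (s t : ℝ), (∀ y : ℝ, 0 ≤ y → s + y * t ≤ omegaRect K 1 y 1) →
      G (j + 1) s t ≤ ((r j : ℕ) : ℝ) ^ 7)
    {s t : ℝ} (ht1 : t ≤ 1) (hst : ∀ y : ℝ, 0 ≤ y → s + y * t ≤ omegaRect K 1 y 1)
    (j : ℕ) :
    0 ≤ ((Q j : ℕ) : ℝ) ^ t / r j ∧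
    ((Q j : ℕ) : ℝ) ^ t / r j ≤ 1 - 2 * ((L j : ℝ) / r j) ∧
    (1 - 2 * ((L j : ℝ) / r j)) - ((Q j : ℕ) : ℝ) ^ t / r j ≤ (1 - t) * (3 * 7 ^ j) ∧
    0 ≤ G j s t / r j ∧
    (((Q j : ℕ) : ℝ) ^ t / r j + G j s t / r j) ^ 7 - (((Q j : ℕ) : ℝ) ^ t / r j) ^ 7 ≤ 1 ∧
    G (j + 1) s t / r (j + 1) * (1 + ((1 - (L j : ℝ) / r j) ^ 7 - (1 - 2 * ((L j : ℝ) / r j)) ^ 7)) =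
      (((Q j : ℕ) : ℝ) ^ t / r j + G j s t / r j) ^ 7 - (((Q j : ℕ) : ℝ) ^ t / r j) ^ 7 := by
  obtain ⟨hrpos, hx0, hx1, hQj, -, hr'⟩ := step_normalForm r Q L hL hr hQ1 hsum j
  have hφ0 := phi_nonneg hx0 hx1
  have hQ1r : (1 : ℝ) ≤ (Q j : ℕ) := by exact_mod_cast hQ1 j
  have hQpos : (0 : ℝ) < (Q j : ℕ) := by linarith
  have hθ0 : 0 ≤ ((Q j : ℕ) : ℝ) ^ t := Real.rpow_nonneg hQpos.le t
  have hθQ : ((Q j : ℕ) : ℝ) ^ t ≤ (Q j : ℕ) := by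
    have := Real.rpow_le_rpow_of_exponent_le hQ1r ht1
    rwa [Real.rpow_one] at this
  have hGj := virtual_nonneg Q G hG0 hG s t j
  -- anchor deficit
  have hdef : ((Q j : ℕ) : ℝ) - ((Q j : ℕ) : ℝ) ^ t ≤ (1 - t) * (3 * 7 ^ j) * r j := by
    have h1 : ((Q j : ℕ) : ℝ) ^ t = (Q j : ℕ) * ((Q j : ℕ) : ℝ) ^ (t - 1) := by
      have := Real.rpow_add hQpos 1 (t - 1)
      rw [Real.rpow_one, add_sub_cancel] at this
      exact this
    have h2 := one_sub_rpow_le_mul_log (t := t) hQ1r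
    have hlogQ : Real.log ((Q j : ℕ) : ℝ) ≤ 3 * 7 ^ j := by
      have hQr : ((Q j : ℕ) : ℝ) ≤ r j := by
        have := hsum j
        exact_mod_cast (by omega : Q j ≤ r j)
      exact (Real.log_le_log hQpos hQr).trans (log_r_le r Q L hr hall hL h0 hQ1 hsum j)
    have hQr : ((Q j : ℕ) : ℝ) ≤ r j := by
      have := hsum j
      exact_mod_cast (by omega : Q j ≤ r j)
    have h1t : 0 ≤ 1 - t := by linarith
    have hlog0 : 0 ≤ Real.log ((Q j : ℕ) : ℝ) := Real.log_nonneg hQ1r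
    calc ((Q j : ℕ) : ℝ) - ((Q j : ℕ) : ℝ) ^ t
        = (Q j : ℕ) * (1 - ((Q j : ℕ) : ℝ) ^ (t - 1)) := by rw [h1]; ring
      _ ≤ (Q j : ℕ) * ((1 - t) * Real.log ((Q j : ℕ) : ℝ)) := by gcongr
      _ ≤ r j * ((1 - t) * (3 * 7 ^ j)) := by gcongr
      _ = (1 - t) * (3 * 7 ^ j) * r j := by ring
  -- cap and recursion
  have hr0 : (r j : ℝ) ≠ 0 := hrpos.ne'
  have ex : 1 - 2 * ((L j : ℝ) / r j) = ((Q j : ℕ) : ℝ) / r j := by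
    rw [hQj]; field_simp
  have hGsucc : G (j + 1) s t = (r j : ℝ) ^ 7 *
      ((((Q j : ℕ) : ℝ) ^ t / r j + G j s t / r j) ^ 7 - (((Q j : ℕ) : ℝ) ^ t / r j) ^ 7) := by
    rw [hG j s t]
    field_simp
  have h7 : 0 < (r j : ℝ) ^ 7 := pow_pos hrpos 7
  refine ⟨div_nonneg hθ0 hrpos.le, ?_, ?_, div_nonneg hGj hrpos.le, ?_, ?_⟩
  · rw [ex]
    exact div_le_div_of_nonneg_right hθQ hrpos.le
  · rw [ex, ← sub_div, div_le_iff₀ hrpos]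
    exact hdef
  · have hread' := hread j s t hst
    rw [hGsucc] at hread'
    by_contra hc
    push Not at hc
    nlinarith [mul_lt_mul_of_pos_left hc h7]
  · rw [hGsucc, hr', mul_div_mul_left _ _ h7.ne', div_mul_cancel₀ _ (by linarith : (1 : ℝ) +
      ((1 - (L j : ℝ) / r j) ^ 7 - (1 - 2 * ((L j : ℝ) / r j)) ^ 7) ≠ 0)]

end Virtual


/-! ## §4 The deviation induction and the violation -/

/-- **One transport step of a certified lower bound** `a − b ≤ γ − m` (`a ≥ b`) through the virtual
deviation step with a multiplier lower bound `lo ≤ λ(m)`. [folklore] -/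
theorem deviation_transport {m θ γ γ' m' a b lo E : ℝ} (hm0 : 0 ≤ m) (hm1 : m ≤ 1 / 2)
    (hγ : 0 ≤ γ) (hθ0 : 0 ≤ θ) (hθρ : θ ≤ 1 - 2 * m) (hdef : (1 - 2 * m) - θ ≤ 1 / 100)
    (hcap : (θ + γ) ^ 7 - θ ^ 7 ≤ 1)
    (hγ' : γ' * (1 + ((1 - m) ^ 7 - (1 - 2 * m) ^ 7)) = (θ + γ) ^ 7 - θ ^ 7)
    (hm' : m' * (1 + ((1 - m) ^ 7 - (1 - 2 * m) ^ 7)) = (1 - m) ^ 7 - (1 - 2 * m) ^ 7)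
    (hlo0 : 0 ≤ lo) (hlo : lo ≤ 7 * (1 - m) ^ 6 / (1 + ((1 - m) ^ 7 - (1 - 2 * m) ^ 7)))
    (hab : 0 ≤ a - b) (hD : a - b ≤ γ - m) (hE : 14 * ((1 - 2 * m) - θ) ≤ E) :
    lo * a - (lo * b + E) ≤ γ' - m' := by
  have vds := virtual_deviation_step hm0 hm1 hγ hθ0 hθρ hdef hcap hγ' hm'
  have hlam0 : 0 ≤ 7 * (1 - m) ^ 6 / (1 + ((1 - m) ^ 7 - (1 - 2 * m) ^ 7)) := le_trans hlo0 hlo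
  have h1 : lo * (a - b) ≤ 7 * (1 - m) ^ 6 / (1 + ((1 - m) ^ 7 - (1 - 2 * m) ^ 7)) * (a - b) :=
    mul_le_mul_of_nonneg_right hlo hab
  have h2 : 7 * (1 - m) ^ 6 / (1 + ((1 - m) ^ 7 - (1 - 2 * m) ^ 7)) * (a - b) ≤
      7 * (1 - m) ^ 6 / (1 + ((1 - m) ^ 7 - (1 - 2 * m) ^ 7)) * (γ - m) :=
    mul_le_mul_of_nonneg_left hD hlam0
  have h0 : lo * (a - b) = lo * a - lo * b := by ring
  linarith

/-- **Loss budget**: with `u·3·7ⁿ ≤ 1/100`, `j ≤ n` and `lo ≤ 179/100`,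
`lo·(0.19/7^(n+1−j)) + 14·(u·3·7ʲ) ≤ 0.19/7^(n−j)`. [folklore] -/
theorem loss_budget {u lo : ℝ} {j n : ℕ} (hjn : j ≤ n)
    (hu : u * (3 * 7 ^ n) ≤ 1 / 100) (hlo : lo ≤ 179 / 100) :
    lo * ((19 : ℝ) / 100 / 7 ^ (n + 1 - j)) + 14 * (u * (3 * 7 ^ j)) ≤ (19 : ℝ) / 100 / 7 ^ (n - j) := by
  have hX : (0 : ℝ) < 7 ^ (n - j) := by positivity
  have h7n : (7 : ℝ) ^ j * 7 ^ (n - j) = 7 ^ n := by rw [← pow_add, Nat.add_sub_cancel' hjn]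
  have hsucc : (7 : ℝ) ^ (n + 1 - j) = 7 * 7 ^ (n - j) := by
    rw [show n + 1 - j = (n - j) + 1 by omega, pow_succ]; ring
  have key : u * (3 * 7 ^ j) ≤ 1 / 100 / 7 ^ (n - j) := by
    rw [le_div_iff₀ hX]
    calc u * (3 * 7 ^ j) * 7 ^ (n - j) = u * (3 * (7 ^ j * 7 ^ (n - j))) := by ring
      _ = u * (3 * 7 ^ n) := by rw [h7n]
      _ ≤ 1 / 100 := hu
  have h1 : lo * ((19 : ℝ) / 100 / 7 ^ (n + 1 - j)) ≤ 179 / 100 * ((19 : ℝ) / 100 / 7 ^ (n + 1 - j)) :=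
    mul_le_mul_of_nonneg_right hlo (by positivity)
  rw [hsucc] at h1 ⊢
  have e : (179 : ℝ) / 100 * (19 / 100 / (7 * 7 ^ (n - j))) + 14 * (1 / 100 / 7 ^ (n - j)) =
      (179 / 100 * 19 / 100 / 7 + 14 / 100) / 7 ^ (n - j) := by
    field_simp
  have e2 : ((179 : ℝ) / 100 * 19 / 100 / 7 + 14 / 100) / 7 ^ (n - j) ≤ 19 / 100 / 7 ^ (n - j) :=
    div_le_div_of_nonneg_right (by norm_num) hX.le
  linarith


section Initial

variable (r Q L : ℕ → ℕ) (G : ℕ → ℝ → ℝ → ℝ)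

/-- The initial deviation: `γ₀ − m₀ = (2^s − 2)/6 ≥ (s − 1)/5`. [folklore] -/
theorem initial_deviation (h0r : r 0 = 6) (h0L : L 0 = 2)
    (hG0 : ∀ s t : ℝ, G 0 s t = (2 : ℝ) ^ s) {s : ℝ} (t : ℝ) (hs1 : 1 ≤ s) :
    (s - 1) / 5 ≤ G 0 s t / r 0 - (L 0 : ℝ) / r 0 := by
  rw [hG0, h0r, h0L]
  push_cast
  have h2s : (2 : ℝ) ^ s = 2 * Real.exp (Real.log 2 * (s - 1)) := by
    rw [Real.rpow_def_of_pos two_pos,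
      show Real.log 2 * s = Real.log 2 * (s - 1) + Real.log 2 by ring, Real.exp_add,
      Real.exp_log two_pos]
    ring
  have he := Real.add_one_le_exp (Real.log 2 * (s - 1))
  have hl2 := Real.log_two_gt_d9
  have hv : 0 ≤ s - 1 := by linarith
  have : (0.6931471803 : ℝ) * (s - 1) ≤ Real.log 2 * (s - 1) :=
    mul_le_mul_of_nonneg_right hl2.le hv
  rw [h2s]
  have h6 : (2 : ℝ) * Real.exp (Real.log 2 * (s - 1)) / 6 - 2 / 6 =
      (Real.exp (Real.log 2 * (s - 1)) - 1) / 3 := by ring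
  rw [h6]
  linarith

end Initial

/-! ## §4c Constants: `κ = log₇(179/100)` and the tower order `κ/(1−κ)` -/

/-- `0 < κ = log₇ 1.79 < 1`. [folklore] -/
theorem towerKappa_pos : 0 < Real.logb 7 ((179 : ℝ) / 100) :=
  Real.logb_pos (by norm_num) (by norm_num)

/-- `κ = log₇ 1.79 < 1`. [folklore] -/
theorem towerKappa_lt_one : Real.logb 7 ((179 : ℝ) / 100) < 1 := by
  have h := Real.logb_lt_logb (b := 7) (by norm_num) (by norm_num : (0 : ℝ) < 179 / 100)
    (by norm_num : (179 : ℝ) / 100 < 7)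
  rwa [Real.logb_self_eq_one (by norm_num)] at h


/-- **The tower order exceeds `21/50`**: `κ/(1−κ) > 0.42` (`κ = log₇ 1.79 > 21/71` because
`1.79^71 > 7^21`). [folklore] -/
theorem towerOrder_gt :
    (21 : ℝ) / 50 < Real.logb 7 ((179 : ℝ) / 100) / (1 - Real.logb 7 ((179 : ℝ) / 100)) := by
  have h1 : Real.log ((7 : ℝ) ^ 21) < Real.log (((179 : ℝ) / 100) ^ 71) :=
    Real.log_lt_log (by positivity) (by norm_num)
  rw [Real.log_pow, Real.log_pow] at h1
  push_cast at h1
  have h7 : 0 < Real.log 7 := Real.log_pos (by norm_num)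
  have hκ : (21 : ℝ) / 71 < Real.logb 7 ((179 : ℝ) / 100) := by
    rw [Real.logb, lt_div_iff₀ h7]
    linarith
  have hκ1 := towerKappa_lt_one
  rw [lt_div_iff₀ (by linarith)]
  linarith

/-- **The tower order exceeds the pair order** `log 2/log(11/2) = 0.4066` of kernel XXVI
(`2^50 < (11/2)^21` gives `log 2/log(11/2) < 21/50`). [folklore] -/
theorem pairOrder_lt_towerOrder :
    Real.log 2 / Real.log (11 / 2) <
      Real.logb 7 ((179 : ℝ) / 100) / (1 - Real.logb 7 ((179 : ℝ) / 100)) := by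
  refine lt_trans ?_ towerOrder_gt
  have h1 : Real.log ((2 : ℝ) ^ 50) < Real.log (((11 : ℝ) / 2) ^ 21) :=
    Real.log_lt_log (by positivity) (by norm_num)
  rw [Real.log_pow, Real.log_pow] at h1
  push_cast at h1
  have h11 : 0 < Real.log ((11 : ℝ) / 2) := Real.log_pos (by norm_num)
  rw [div_lt_iff₀ h11]
  linarith

end Summit.MatrixMultiplication.MatrixMultiplication.Theorems.FarEdgeDescentTowerDeviation

end
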